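import Summits.ResolutionOfSingularities.ResolutionOfSingularities.Theorems.FrobeniusLadderFInjectiveMacaulayficationRegularOffCodimFourResidueReduced
import Summits.ResolutionOfSingularities.ResolutionOfSingularities.Theorems.FrobeniusLadderFInjectiveMacaulayficationUReduction
import HarnessLib

/-!
# LINE U: the stub (U1) `UReduction.RegularOffCodimFourResidue` DISCHARGED BY NAME, modulo the three threefold named facts
# (crux `FInjectiveMacaulayfication` stmt-ResolutionOfSingularities-15315, chain w45a; res-L1-w45a-plan-1 R15.42 (1) «on ✓: line U's
# `stub_regularOffCodimFourResidue` closes by name»; seat res-L1-w45a-stub-3)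

[OURS · L1 W4.5a] Support file (`--supports stmt-ResolutionOfSingularities-15315 --as helper`); NOT a statement of any manuscript; AI-written
(AI review is weaker than expert review). `regularOffCodimFourResidue_of_cp3 : CossartPiltant2019General → Stacks081R →
CossartPiltant2019Principalization → UReduction.RegularOffCodimFourResidue` — the tree's line-U stub text (`…UReduction.lean`) is
character for character the conclusion of `RegularOffCodimFourResidueReduced.regularOffCodimFourResidue_of_cp` (Temkin 2008 Prop. 2.3.4
truncated at codimension 4 + Cossart–Piltant 2019, integral case p557070, component glue p558160), so the stub closes by `exact`.
Consumers: `UReduction.FInjectiveMacaulayfication_of_fi (regularOffCodimFourResidue_of_cp3 hG h081R hP) hCM hFI : crux` (res-L1-w45a-stub-2's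
headline file adds `hCM` from Česnavičius). [folklore assembly; cite: Temkin2008, Prop. 2.3.4; CossartPiltant2019, Thm. 1.1]
-/

-- single-problem summit: the doubled namespace component is forced
set_option linter.dupNamespace false

noncomputable section

open Literature.AlgebraicGeometry.Resolution

namespace Summit.ResolutionOfSingularities.ResolutionOfSingularities.Theorems.FInjectiveMacaulayfication.UReduction

open Summit.ResolutionOfSingularities.ResolutionOfSingularities.Theorems.FInjectiveMacaulayfication

/-- **(U1) holds modulo the three threefold named facts**: the line-U stub `RegularOffCodimFourResidue` (every reduced separated finite-type
scheme over a field of positive characteristic has a proper birational reduced model regular off the preimage of a closed set of points of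
local dimension `≥ 4`) from `CossartPiltant2019General`, `Stacks081R`, `CossartPiltant2019Principalization`.
[folklore assembly; cite: Temkin2008, Prop. 2.3.4; CossartPiltant2019, Thm. 1.1] -/
theorem regularOffCodimFourResidue_of_cp3
    (hG : CossartPiltant2019General.{0}) (h081R : Stacks081R.{0}) (hP : CossartPiltant2019Principalization.{0}) :
    RegularOffCodimFourResidue :=
  RegularOffCodimFourResidueReduced.regularOffCodimFourResidue_of_cp hG h081R hP

/-- Hence **the crux follows from (PF_CM) and (PF_FI) alone**, modulo the three threefold named facts (composition with the tree's
`UReduction.FInjectiveMacaulayfication_of_fi`). [OURS assembly; cite: Temkin2008, Prop. 2.3.4; CossartPiltant2019, Thm. 1.1] -/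
theorem FInjectiveMacaulayfication_of_cm_fi
    (hG : CossartPiltant2019General.{0}) (h081R : Stacks081R.{0}) (hP : CossartPiltant2019Principalization.{0})
    (hCM : CMOverCodimFourResidue) (hFI : FIOverCMResidue) :
    Summit.ResolutionOfSingularities.ResolutionOfSingularities.Theses.FrobeniusLadder.FInjectiveMacaulayfication :=
  FInjectiveMacaulayfication_of_fi (regularOffCodimFourResidue_of_cp3 hG h081R hP) hCM hFI

end Summit.ResolutionOfSingularities.ResolutionOfSingularities.Theorems.FInjectiveMacaulayfication.UReduction

end
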